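import Summits.Ventures.PercRepro.RankLevelSetDepCountHeavyB
import Summits.Ventures.PercRepro.RankLevelSetLevelSixHeavyCell

/-!
# PercRepro — THE COLOOP-FREE FLAT CAP: A PROPER FLAT OF A COLOOP-FREE MATROID HAS NULLITY `≤ d − 1` (p8 g10, S3)

`proofs/SUBCLAIM-S3-p8.md` §3x. In a matroid of corank `d` every set `X` has `|X| ≤ r(X) + d` (the nullity cap); if `X` is
not spanning and `M` has no coloop the cap drops by one: `|X| + 1 ≤ r(X) + d` (`ncard_add_one_le_eRk_add_of_coloopFree`).
Proof: the flat `F = cl(X)` has `|F| ≤ r(F) + d` with equality forcing every `x ∈ E ∖ F` (non-empty, `F` is not spanning) to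
be a coloop — `r(E ∖ x) ≤ r(F) + |E ∖ F ∖ x| = r(E) − 1`, so `x ∉ cl(E ∖ x)`. Hence on a coloop-free core the rank-`6`
flats have `≤ 5 + d` points and the rank-`5` flats `≤ 4 + d`, and at `ν₁ ≥ d` the heavy classes are EMPTY:
`UG_eq_empty_of_cap`, with `UH_eq_empty` (RankLevelSetDepCountHeavyB). Axioms: standard.
-/

open scoped Matroid

namespace PercRepro

namespace ThmN

open Set

variable {α : Type}

/-- **The coloop-free flat cap**: in a coloop-free matroid of rank `p` and corank `d`, a set `X` of rank `r < p` has
`|X| + 1 ≤ r + d`. -/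
theorem ncard_add_one_le_eRk_add_of_coloopFree (M : Matroid α) [M.Finite]
    (hcf : ∀ e ∈ M.E, ¬ M.IsColoop e) {p d : ℕ} (hR : M.eRank = (p : ℕ∞)) (hn : M.E.ncard = p + d)
    {X : Set α} (hX : X ⊆ M.E) {r : ℕ} (hr : M.eRk X = r) (hlt : r < p) :
    X.ncard + 1 ≤ r + d := by
  classical
  have hd : M.E.encard = M.eRank + d := by
    rw [hR, ← M.ground_finite.cast_ncard_eq, hn]
    push_cast; ring
  set F := M.closure X with hF
  have hFE : F ⊆ M.E := M.closure_subset_ground X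
  have hFr : M.eRk F = r := by rw [hF, M.eRk_closure_eq, hr]
  have hXF : X ⊆ F := M.subset_closure X hX
  have hFfin : F.Finite := M.ground_finite.subset hFE
  have hXF' : X.ncard ≤ F.ncard := Set.ncard_le_ncard hXF hFfin
  have hFcap : F.ncard ≤ r + d := Matroid.ncard_le_add_of_eRk_eq hFE hd hFr
  by_contra hcon
  push Not at hcon
  have hFeq : F.ncard = r + d := by omega
  -- `F` is not the ground set: pick `x ∈ E ∖ F`
  have hne : (M.E \ F).Nonempty := by
    by_contra h
    rw [Set.not_nonempty_iff_eq_empty, Set.sdiff_eq_empty] at h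
    have hEF : F = M.E := subset_antisymm hFE h
    have : M.eRk M.E = r := by rw [← hEF]; exact hFr
    rw [M.eRk_ground, hR] at this
    have : p = r := by exact_mod_cast this
    omega
  obtain ⟨x, hxE, hxF⟩ := hne
  -- `E ∖ {x} = F ∪ ((E ∖ {x}) ∖ F)` has rank `≤ r + (p − r − 1) = p − 1`
  have hFsub : F ⊆ M.E \ {x} := fun y hy => ⟨hFE hy, fun h => hxF (by rw [Set.mem_singleton_iff] at h; rw [← h]; exact hy)⟩
  have hunion : M.E \ {x} = F ∪ ((M.E \ {x}) \ F) := (Set.union_sdiff_cancel hFsub).symm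
  have hYcard : ((M.E \ {x}) \ F).ncard = p - r - 1 := by
    have h1 : ((M.E \ {x}) \ F).ncard = (M.E \ {x}).ncard - F.ncard :=
      Set.ncard_sdiff' hFsub (M.ground_finite.subset Set.sdiff_subset)
    have h2 : (M.E \ {x}).ncard = M.E.ncard - 1 := by
      rw [Set.ncard_sdiff_singleton_of_mem hxE]
    rw [h1, h2, hn, hFeq]
    omega
  have hrk : M.eRk (M.E \ {x}) ≤ ((p - 1 : ℕ) : ℕ∞) := by
    rw [hunion]
    have h1 := M.eRk_union_le_eRk_add_encard F ((M.E \ {x}) \ F)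
    have hYfin : ((M.E \ {x}) \ F).Finite := M.ground_finite.subset (Set.sdiff_subset.trans Set.sdiff_subset)
    rw [hFr, ← hYfin.cast_ncard_eq, hYcard] at h1
    refine h1.trans ?_
    norm_cast
    omega
  -- hence `x ∉ cl(E ∖ {x})`: `x` is a coloop
  have hxcl : x ∉ M.closure (M.E \ {x}) := by
    intro hx
    have hsub : M.E ⊆ M.closure (M.E \ {x}) := by
      intro y hy
      by_cases hyx : y = x
      · rw [hyx]; exact hx
      · exact M.subset_closure (M.E \ {x}) Set.sdiff_subset ⟨hy, hyx⟩
    have h1 : M.eRk M.E ≤ M.eRk (M.closure (M.E \ {x})) := M.eRk_mono hsub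
    rw [M.eRk_closure_eq, M.eRk_ground, hR] at h1
    have h2 : (p : ℕ∞) ≤ ((p - 1 : ℕ) : ℕ∞) := h1.trans hrk
    have h3 : p ≤ p - 1 := by exact_mod_cast h2
    omega
  exact hcf x hxE ((Matroid.isColoop_iff_notMem_closure_compl hxE).2 hxcl)

/-- The rank-`6` sets of a coloop-free core of rank `p ≥ 7` have at most `5 + d` points. -/
theorem ncard_le_five_add_of_coloopFree (M : Matroid α) [M.Finite]
    (hcf : ∀ e ∈ M.E, ¬ M.IsColoop e) {p d : ℕ} (hR : M.eRank = (p : ℕ∞)) (hn : M.E.ncard = p + d) (hp : 7 ≤ p)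
    {X : Set α} (hX : X ⊆ M.E) (hr : M.eRk X ≤ 6) : X.ncard ≤ 5 + d := by
  have hfin : X.Finite := M.ground_finite.subset hX
  have hle : M.eRk X ≤ X.encard := M.eRk_le_encard X
  obtain ⟨r, hr'⟩ : ∃ r : ℕ, M.eRk X = r := by
    have := (M.eRk_le_encard X).trans_lt (hfin.encard_lt_top)
    exact ⟨(M.eRk X).toNat, (ENat.coe_toNat this.ne).symm⟩
  have hr6 : r ≤ 6 := by rw [hr'] at hr; exact_mod_cast hr
  have := ncard_add_one_le_eRk_add_of_coloopFree M hcf hR hn hX hr' (by omega)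
  omega

/-- The rank-`≤ 5` sets of a coloop-free core of rank `p ≥ 6` have at most `4 + d` points. -/
theorem ncard_le_four_add_of_coloopFree (M : Matroid α) [M.Finite]
    (hcf : ∀ e ∈ M.E, ¬ M.IsColoop e) {p d : ℕ} (hR : M.eRank = (p : ℕ∞)) (hn : M.E.ncard = p + d) (hp : 6 ≤ p)
    {X : Set α} (hX : X ⊆ M.E) (hr : M.eRk X ≤ ((6 - 1 : ℕ) : ℕ∞)) : X.ncard ≤ 4 + d := by
  have hfin : X.Finite := M.ground_finite.subset hX
  obtain ⟨r, hr'⟩ : ∃ r : ℕ, M.eRk X = r := by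
    have := (M.eRk_le_encard X).trans_lt (hfin.encard_lt_top)
    exact ⟨(M.eRk X).toNat, (ENat.coe_toNat this.ne).symm⟩
  have hr5 : r ≤ 5 := by
    rw [hr'] at hr
    have : ((r : ℕ) : ℕ∞) ≤ ((5 : ℕ) : ℕ∞) := by simpa using hr
    exact_mod_cast this
  have := ncard_add_one_le_eRk_add_of_coloopFree M hcf hR hn hX hr' (by omega)
  omega

/-- **No good heavy rank-`q` flat under a flat cap**: if every set of rank `≤ q` has at most `f` points and
`f + 1 ≤ q + ν₁`, then `UG M q ν₁ = ∅`. -/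
theorem UG_eq_empty_of_cap (M : Matroid α) [M.Finite] {q ν₁ f : ℕ}
    (hflat : ∀ X ⊆ M.E, M.eRk X ≤ (q : ℕ∞) → X.ncard ≤ f) (h : f + 1 ≤ q + ν₁) :
    Matroid.UG M q ν₁ = ∅ := by
  rw [Set.eq_empty_iff_forall_notMem]
  intro x hx
  unfold Matroid.UG at hx
  rw [Set.mem_iUnion₂] at hx
  obtain ⟨F, hF, -⟩ := hx
  have hF' := Matroid.mem_goodFlats.1 hF
  obtain ⟨hFE, -, hrF, hνF, -⟩ := hF'
  have := hflat F hFE (le_of_eq hrF)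
  omega

end ThmN

end PercRepro
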